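import Literature.Analysis.FluidPDE.StokesTorus

/-!
# Route EnsembleRigidity · crux `GPMeanBoundedFamily` — posited objects of line `Sketch`
  (idea `pyritohedral-head-neck-body`; D-0016 `<Route>Defs` convention)

Vocabulary for the line `Sketch` of crux stmt-AnomalousDissipation-15509
(`EnsembleRigidity.GPMeanBoundedFamily`): the pinned Galloway–Proctor force, its Lamb mode, and the
three generators of the stabiliser `G ≅ C₃ ⋉ {±1}³` (order 24) of the force in the affine
hyperoctahedral group of `T³`, with the resulting symmetry predicate on vector fields. This file
carries no mathematics beyond definitions and one `rfl` lemma.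

* `gpForce` — `f_GP(x) = sin(2πx₂)e₀ + sin(2πx₀)e₁ + sin(2πx₁)e₂`, byte-identical to the inline sum of
  three Stokes modes in the route declarations (`gpForce_eq` is `rfl`).
* `lambMode` — the Lamb mode `g = (f_GP·∇)f_GP / (2π) = (sin2πx₁ cos2πx₂, sin2πx₂ cos2πx₀, sin2πx₀ cos2πx₁)`,
  written by the product-to-sum formula as one half of a sum of six Stokes sine modes on the shell
  `|k|² = 2` (frequencies `e₁ ± e₂`, `e₂ ± e₀`, `e₀ ± e₁` with amplitudes `e₀`, `e₁`, `e₂`), so that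
  smoothness, solenoidality (`k · a = 0`) and the zero mean are those of `Torus.stokesMode`.
* `halfPeriod`, `cycShift`, `twistTurn` — `½ ∈ ℝ/ℤ`, the coordinate 3-cycle `y ↦ (y₁, y₂, y₀)` and the
  twisted half-turn `y ↦ (y₀ + ½, −y₁, −y₂ + ½)`; together with the inversion `y ↦ −y` they generate
  the stabiliser of `f_GP` (order 24, checked by exact enumeration in the line's notes).
* `IsGPSymmetric u` — covariance of a vector field under the three generators
  (`u(Qy + b) = Q u(y)`): cyclic covariance, oddness, twisted half-turn covariance.

Everything is a definition over existing declarations (`Torus.stokesMode`, `EuclideanSpace.single`,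
`Pi.single`, `Matrix.vecCons`). This module deliberately does NOT import the route file
`Theses.EnsembleRigidity`.
-/

noncomputable section

-- every `Summit.AnomalousDissipation.AnomalousDissipation.…` name repeats the summit = sub-problem segment (D-0017 layout)
set_option linter.dupNamespace false

namespace Summit.AnomalousDissipation.AnomalousDissipation.Theorems.EnsembleRigidity

open Literature.Analysis.FluidPDE

/-- The pinned **Galloway–Proctor force** `f_GP(x) = sin(2πx₂)e₀ + sin(2πx₀)e₁ + sin(2πx₁)e₂` on `T³`,
the inline sum of the three Stokes sine modes `Torus.stokesMode eⱼ eᵢ false` with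
`(j, i) = (2, 0), (0, 1), (1, 2)`, character for character the expression pinned in the route
declarations of `EnsembleRigidity` (Galloway–Proctor, Nature 356 (1992)). -/
def gpForce : UnitAddTorus (Fin 3) → EuclideanSpace ℝ (Fin 3) := fun x : UnitAddTorus (Fin 3) =>
  (Literature.Analysis.FluidPDE.Torus.stokesMode (Pi.single (2 : Fin 3) (1 : ℤ)) (EuclideanSpace.single (0 : Fin 3) (1 : ℝ)) false x +
    Literature.Analysis.FluidPDE.Torus.stokesMode (Pi.single (0 : Fin 3) (1 : ℤ)) (EuclideanSpace.single (1 : Fin 3) (1 : ℝ)) false x +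
    Literature.Analysis.FluidPDE.Torus.stokesMode (Pi.single (1 : Fin 3) (1 : ℤ)) (EuclideanSpace.single (2 : Fin 3) (1 : ℝ)) false x :
    EuclideanSpace ℝ (Fin 3))

/-- `gpForce` is, by definition, the inline expression of the route declarations. -/
theorem gpForce_eq : gpForce = fun x : UnitAddTorus (Fin 3) =>
    (Literature.Analysis.FluidPDE.Torus.stokesMode (Pi.single (2 : Fin 3) (1 : ℤ)) (EuclideanSpace.single (0 : Fin 3) (1 : ℝ)) false x +
      Literature.Analysis.FluidPDE.Torus.stokesMode (Pi.single (0 : Fin 3) (1 : ℤ)) (EuclideanSpace.single (1 : Fin 3) (1 : ℝ)) false x +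
      Literature.Analysis.FluidPDE.Torus.stokesMode (Pi.single (1 : Fin 3) (1 : ℤ)) (EuclideanSpace.single (2 : Fin 3) (1 : ℝ)) false x :
      EuclideanSpace ℝ (Fin 3)) := rfl

/-- The **Lamb mode** `g = (f_GP·∇)f_GP / (2π) = (sin2πx₁ cos2πx₂, sin2πx₂ cos2πx₀, sin2πx₀ cos2πx₁)`
of the Galloway–Proctor force, written by `sin a cos b = ½(sin(a+b) + sin(a−b))` as one half of the
sum of the six Stokes sine modes with frequencies `e₁ ± e₂`, `e₂ ± e₀`, `e₀ ± e₁` (shell `|k|² = 2`)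
and amplitudes `e₀`, `e₁`, `e₂`; solenoidal (`k · a = 0` for each mode), mean zero, `∫|g|² = 3/4`.
It spans the symmetric part of the second shell (line `Sketch`, idea `pyritohedral-head-neck-body`). -/
def lambMode : UnitAddTorus (Fin 3) → EuclideanSpace ℝ (Fin 3) := fun x =>
  (1 / 2 : ℝ) • (Torus.stokesMode ![0, 1, 1] (EuclideanSpace.single (0 : Fin 3) (1 : ℝ)) false x +
    Torus.stokesMode ![0, 1, -1] (EuclideanSpace.single (0 : Fin 3) (1 : ℝ)) false x +
    Torus.stokesMode ![1, 0, 1] (EuclideanSpace.single (1 : Fin 3) (1 : ℝ)) false x +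
    Torus.stokesMode ![-1, 0, 1] (EuclideanSpace.single (1 : Fin 3) (1 : ℝ)) false x +
    Torus.stokesMode ![1, 1, 0] (EuclideanSpace.single (2 : Fin 3) (1 : ℝ)) false x +
    Torus.stokesMode ![1, -1, 0] (EuclideanSpace.single (2 : Fin 3) (1 : ℝ)) false x :
    EuclideanSpace ℝ (Fin 3))

/-- The half period `½ ∈ ℝ/ℤ`. -/
def halfPeriod : UnitAddCircle := ((1 / 2 : ℝ) : UnitAddCircle)

/-- Generator 1 of the stabiliser of `f_GP` (torus side): the coordinate 3-cycle `y ↦ (y₁, y₂, y₀)`. -/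
def cycShift (y : UnitAddTorus (Fin 3)) : UnitAddTorus (Fin 3) := fun j => y (j + 1)

/-- Generator 3 of the stabiliser of `f_GP` (torus side): the twisted half-turn
`y ↦ (y₀ + ½, −y₁, −y₂ + ½)` (linear part `diag(1,−1,−1)`, translation `(½, 0, ½)`); generator 2 is
the inversion `y ↦ −y`. -/
def twistTurn (y : UnitAddTorus (Fin 3)) : UnitAddTorus (Fin 3) :=
  ![y 0 + halfPeriod, -(y 1), -(y 2) + halfPeriod]

/-- **`G`-symmetry** of a vector field on `T³`, `G` the stabiliser of `f_GP` (order 24): covariance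
`u(Qy + b) = Q u(y)` under the three generators — the coordinate 3-cycle (`u (cycShift y) i = u y (i+1)`),
the inversion (`u (−y) = −u y`, whence zero momentum and zero helicity) and the twisted half-turn
(`u (twistTurn y) = diag(1,−1,−1) u y`). `gpForce` and `lambMode` are `G`-symmetric; the cosine partner
`curl f_GP / 2π` is not (it is even). -/
def IsGPSymmetric (u : UnitAddTorus (Fin 3) → EuclideanSpace ℝ (Fin 3)) : Prop :=
  (∀ (y : UnitAddTorus (Fin 3)) (i : Fin 3), u (cycShift y) i = u y (i + 1)) ∧
  (∀ (y : UnitAddTorus (Fin 3)) (i : Fin 3), u (-y) i = -(u y i)) ∧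
  (∀ y : UnitAddTorus (Fin 3), u (twistTurn y) 0 = u y 0 ∧ u (twistTurn y) 1 = -(u y 1) ∧
    u (twistTurn y) 2 = -(u y 2))

end Summit.AnomalousDissipation.AnomalousDissipation.Theorems.EnsembleRigidity

end
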